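import Mathlib

/-!
# Route `NodalDiracTwist` — support `TwistCalibrationBdG`: pinning and the node sign (holonomy, part 3)

Real-variable lemmas for the SECOND CLAUSE of `TwistCalibrationBdG` (stmt-HubbardSuperconductivity-1625):
* `eq_zero_of_cos_grid_eq` (**pinning**): for `c ∈ (0, π)` with `cos c = cos(Lκ)`, `|p| = c` and
  `|u| ≤ r < min(c, π - c)`, a shifted grid momentum `(2πv + p + u)/L` with `cos = cos κ` forces `u = 0` —
  the closed loop disk of radius `r` around a quartet point meets the lattice `(±c + 2πℤ)²` of
  degeneracies only at its centre;
* `exists_sign_cos_sub_cos` (**transversality**): if `g(u) = cos(Q + u/L) - cos κ` (`cos Q = cos κ`,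
  `κ ∈ (0, π)`) vanishes on `[-r, r]` only at `0`, then `ε g < 0` on `(0, r]` and `ε g > 0` on `[-r, 0)`
  for a sign `ε = ±1` (sum-to-product near `0`, intermediate value theorem away from `0`).

Folklore. No definitions.
-/

-- the mandated namespace `Summit.<Summit>.<Problem>.Theorems` repeats `HubbardSuperconductivity`
-- (single-problem summit, D-0017), which the `dupNamespace` linter flags on every declaration
set_option linter.dupNamespace false

namespace Summit.HubbardSuperconductivity.HubbardSuperconductivity.Theorems.NodalDiracTwist

open Set

variable {L : ℕ} [NeZero L]

/-! ### Pinning: inside the loop disk a node coordinate forces the centre -/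

/-- **Pinning lemma.** Let `c ∈ (0, π)` with `cos c = cos(Lκ)`, `|p| = c`, `|u| ≤ r < min(c, π-c)`.
If the shifted grid momentum `(2πv + p + u)/L` (`v ∈ ℕ`) has `cos = cos κ`, then `u = 0`: the loop of
radius `r` around a quartet point meets no other point of the lattice `(±c + 2πℤ)`. [folklore] -/
theorem eq_zero_of_cos_grid_eq {κ c p u r : ℝ} (v : ℕ) (hc0 : 0 < c) (hcπ : c < Real.pi)
    (hcos : Real.cos c = Real.cos (L * κ)) (hp : |p| = c) (hu : |u| ≤ r) (hr : r < min c (Real.pi - c))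
    (h : Real.cos (2 * Real.pi * v / L + (p + u) / L) = Real.cos κ) : u = 0 := by
  have hL : (L : ℝ) ≠ 0 := Nat.cast_ne_zero.mpr (NeZero.ne L)
  have hpi := Real.pi_pos
  have hrc : r < c := lt_of_lt_of_le hr (min_le_left _ _)
  have hrc' : r < Real.pi - c := lt_of_lt_of_le hr (min_le_right _ _)
  -- `cos (p + u) = cos (L κ) = cos c = cos p`
  have h1 : Real.cos (p + u) = Real.cos p := by
    have hcp : Real.cos p = Real.cos c := by rw [← Real.cos_abs p, hp]
    rw [hcp, hcos]
    rw [Real.cos_eq_cos_iff] at h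
    obtain ⟨j, hj | hj⟩ := h
    · have : p + u = L * κ + ((-(j * (L : ℤ) + (v : ℤ))) : ℤ) * (2 * Real.pi) := by
        rw [hj]; push_cast; field_simp; ring
      rw [this, Real.cos_add_int_mul_two_pi]
    · have : p + u = -(L * κ) + (((j * (L : ℤ) - (v : ℤ))) : ℤ) * (2 * Real.pi) := by
        rw [hj]; push_cast; field_simp; ring
      rw [this, Real.cos_add_int_mul_two_pi, Real.cos_neg]
  rw [Real.cos_eq_cos_iff] at h1
  obtain ⟨m, hm | hm⟩ := h1
  · -- `p = 2mπ + (p + u)`: `u = -2mπ`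
    have hu' : u = -(2 * m * Real.pi) := by linarith
    rcases lt_trichotomy m 0 with hm0 | rfl | hm0
    · have : (m : ℝ) ≤ -1 := by exact_mod_cast Int.le_sub_one_of_lt hm0
      have : u ≥ 2 * Real.pi := by rw [hu']; nlinarith
      linarith [abs_le.mp (hu.trans hrc.le)]
    · rw [hu']; simp
    · have : (1 : ℝ) ≤ m := by exact_mod_cast hm0
      have : u ≤ -(2 * Real.pi) := by rw [hu']; nlinarith
      linarith [abs_le.mp (hu.trans hrc.le)]
  · -- `p = 2mπ - (p + u)`: `u = 2mπ - 2p`, `p = ±c`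
    exfalso
    have hu' : u = 2 * m * Real.pi - 2 * p := by linarith
    have hub := abs_le.mp hu
    rcases (abs_eq hc0.le).mp hp with rfl | rfl
    · rcases le_or_gt m 0 with hm0 | hm0
      · have : (m : ℝ) ≤ 0 := by exact_mod_cast hm0
        nlinarith
      · have : (1 : ℝ) ≤ m := by exact_mod_cast hm0
        nlinarith
    · rcases le_or_gt 0 m with hm0 | hm0
      · rcases eq_or_lt_of_le hm0 with rfl | hm1
        · simp at hu'; linarith
        · have : (1 : ℝ) ≤ m := by exact_mod_cast hm1
          nlinarith
      · have : (m : ℝ) ≤ -1 := by exact_mod_cast Int.le_sub_one_of_lt hm0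
        nlinarith

/-! ### The sign of `cos(Q + u/L) - cos κ` near a node -/

/-- **Sign of the node function.** Let `κ ∈ (0, π)`, `cos Q = cos κ`, `r > 0`, and suppose
`g(u) = cos(Q + u/L) - cos κ` vanishes on `[-r, r]` only at `u = 0`. Then there is a sign `ε = ±1`
(`+1` iff `Q ≡ κ`, `-1` iff `Q ≡ -κ (mod 2π)`) with `ε g < 0` on `(0, r]` and `ε g > 0` on
`[-r, 0)`: the zero of `g` at the node is simple and transversal. [folklore] -/
theorem exists_sign_cos_sub_cos {κ Q r : ℝ} (hκ0 : 0 < κ) (hκπ : κ < Real.pi) (hr : 0 < r)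
    (hQ : Real.cos Q = Real.cos κ)
    (hzero : ∀ u, |u| ≤ r → Real.cos (Q + u / L) - Real.cos κ = 0 → u = 0) :
    ∃ ε : ℝ, (ε = 1 ∨ ε = -1) ∧
      (∀ u ∈ Set.Ioc 0 r, ε * (Real.cos (Q + u / L) - Real.cos κ) < 0) ∧
      (∀ u ∈ Set.Ico (-r) 0, 0 < ε * (Real.cos (Q + u / L) - Real.cos κ)) := by
  have hL0 : (0 : ℝ) < L := Nat.cast_pos.mpr (Nat.pos_of_ne_zero (NeZero.ne L))
  have hpi := Real.pi_pos
  -- `Q = 2jπ ± κ`, so `g(u) = G(ε u)` with `G(w) = cos(κ + w/L) - cos κ`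
  rw [Real.cos_eq_cos_iff] at hQ
  obtain ⟨j, hj⟩ := hQ
  obtain ⟨ε, hε, hg⟩ : ∃ ε : ℝ, (ε = 1 ∨ ε = -1) ∧ ∀ u : ℝ,
      Real.cos (Q + u / L) - Real.cos κ = Real.cos (κ + ε * u / L) - Real.cos κ := by
    rcases hj with hj | hj
    · refine ⟨1, Or.inl rfl, fun u => ?_⟩
      have hQ' : Q = κ - 2 * j * Real.pi := by linarith
      rw [hQ', one_mul, show κ - 2 * (j : ℝ) * Real.pi + u / L = κ + u / L + ((-j : ℤ) : ℝ) * (2 * Real.pi) by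
        push_cast; ring, Real.cos_add_int_mul_two_pi]
    · refine ⟨-1, Or.inr rfl, fun u => ?_⟩
      have hQ' : Q = 2 * j * Real.pi - κ := by linarith
      rw [hQ', show 2 * (j : ℝ) * Real.pi - κ + u / L = -(κ + -1 * u / L) + j * (2 * Real.pi) by ring,
        Real.cos_add_int_mul_two_pi, Real.cos_neg]
  -- `G(w) < 0` for small `w > 0`, `G(w) > 0` for small `w < 0` (sum-to-product)
  set G : ℝ → ℝ := fun w => Real.cos (κ + w / L) - Real.cos κ with hGdef
  have hGc : Continuous G := by
    simp only [hGdef]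
    fun_prop
  set w₀ : ℝ := min r (L * min κ (Real.pi - κ)) with hw₀
  have hw₀pos : 0 < w₀ := lt_min hr (mul_pos hL0 (lt_min hκ0 (by linarith)))
  have hsmall : ∀ w, 0 < |w| → |w| < L * min κ (Real.pi - κ) →
      (0 < w → G w < 0) ∧ (w < 0 → 0 < G w) := by
    intro w hw0 hw1
    have hform : G w = -2 * Real.sin (κ + w / (2 * L)) * Real.sin (w / (2 * L)) := by
      have e1 : (κ + w / L + κ) / 2 = κ + w / (2 * L) := by field_simp; ring
      have e2 : (κ + w / L - κ) / 2 = w / (2 * L) := by field_simp; ring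
      simp only [hGdef]
      rw [Real.cos_sub_cos, e1, e2]
    have hwL : |w| / L < min κ (Real.pi - κ) := by rwa [div_lt_iff₀' hL0]
    have hmin1 := min_le_left κ (Real.pi - κ)
    have hmin2 := min_le_right κ (Real.pi - κ)
    have hs1 : 0 < Real.sin (κ + w / (2 * L)) := by
      apply Real.sin_pos_of_pos_of_lt_pi
      · have : -(|w|) ≤ w := neg_abs_le w
        have : -(|w| / L) ≤ w / L := by rw [← neg_div]; exact div_le_div_of_nonneg_right this hL0.le
        have : w / (2 * L) = (w / L) / 2 := by field_simp
        rw [this]; linarith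
      · have : w ≤ |w| := le_abs_self w
        have : w / L ≤ |w| / L := div_le_div_of_nonneg_right this hL0.le
        have : w / (2 * L) = (w / L) / 2 := by field_simp
        rw [this]; linarith
    constructor
    · intro hw
      have hs2 : 0 < Real.sin (w / (2 * L)) := by
        apply Real.sin_pos_of_pos_of_lt_pi (by positivity)
        have : w / (2 * L) = (w / L) / 2 := by field_simp
        rw [this, abs_of_pos hw] at *; linarith
      rw [hform]; nlinarith [mul_pos hs1 hs2]
    · intro hw
      have hs2 : Real.sin (w / (2 * L)) < 0 := by
        rw [← neg_pos, ← Real.sin_neg]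
        apply Real.sin_pos_of_pos_of_lt_pi
        · rw [neg_pos]; exact div_neg_of_neg_of_pos hw (by positivity)
        · rw [abs_of_neg hw] at hwL
          have : -(w / (2 * L)) = (-w / L) / 2 := by field_simp
          rw [this]; linarith
      rw [hform]; nlinarith [mul_neg_of_pos_of_neg hs1 hs2]
  -- no zeros of `G` on `[-r, r] ∖ {0}` (in the `ε`-twisted variable)
  have hGzero : ∀ w, |w| ≤ r → G w = 0 → w = 0 := by
    intro w hw h0
    have h1 : Real.cos (Q + (ε * w) / L) - Real.cos κ = 0 := by
      rw [hg]
      have : ε * (ε * w) = w := by rcases hε with h | h <;> rw [h] <;> ring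
      rw [this]; exact h0
    have := hzero (ε * w) (by rcases hε with h | h <;> rw [h] <;> simp [hw]) h1
    rcases hε with h | h <;> rw [h] at this <;> simpa using this
  -- `G < 0` on `(0, r]`, `G > 0` on `[-r, 0)` by the intermediate value theorem
  have hGneg : ∀ u ∈ Set.Ioc 0 r, G u < 0 := by
    intro u hu
    by_contra hcon
    push Not at hcon
    set w := min (u / 2) (w₀ / 2) with hw
    have hwpos : 0 < w := lt_min (by linarith [hu.1]) (by linarith)
    have hwu : w < u := lt_of_le_of_lt (min_le_left _ _) (by linarith [hu.1])
    have hwlt : |w| < L * min κ (Real.pi - κ) := by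
      rw [abs_of_pos hwpos]
      calc w ≤ w₀ / 2 := min_le_right _ _
        _ < w₀ := by linarith
        _ ≤ _ := min_le_right _ _
    have hGw : G w < 0 := (hsmall w (by rw [abs_of_pos hwpos]; exact hwpos) hwlt).1 hwpos
    -- IVT on `[w, u]`
    obtain ⟨x, hx, hx0⟩ : ∃ x ∈ Set.Icc w u, G x = 0 :=
      intermediate_value_Icc hwu.le hGc.continuousOn ⟨hGw.le, hcon⟩
    have := hGzero x (by rw [abs_of_pos (by linarith [hx.1])]; linarith [hx.2, hu.2]) hx0
    linarith [hx.1]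
  have hGpos : ∀ u ∈ Set.Ico (-r) 0, 0 < G u := by
    intro u hu
    by_contra hcon
    push Not at hcon
    set w := max (u / 2) (-(w₀ / 2)) with hw
    have hwneg : w < 0 := max_lt (by linarith [hu.2]) (by linarith)
    have hwu : u < w := lt_of_lt_of_le (by linarith [hu.2]) (le_max_left _ _)
    have hwlt : |w| < L * min κ (Real.pi - κ) := by
      rw [abs_of_neg hwneg]
      calc -w ≤ w₀ / 2 := by linarith [le_max_right (u / 2) (-(w₀ / 2))]
        _ < w₀ := by linarith
        _ ≤ _ := min_le_right _ _
    have hGw : 0 < G w := (hsmall w (by rw [abs_of_neg hwneg]; linarith) hwlt).2 hwneg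
    obtain ⟨x, hx, hx0⟩ : ∃ x ∈ Set.Icc u w, G x = 0 :=
      intermediate_value_Icc hwu.le hGc.continuousOn ⟨hcon, hGw.le⟩
    have := hGzero x (by rw [abs_of_neg (by linarith [hx.2])]; linarith [hx.1, hu.1]) hx0
    linarith [hx.2]
  refine ⟨ε, hε, fun u hu => ?_, fun u hu => ?_⟩
  · rw [hg]
    rcases hε with h | h
    · rw [h, one_mul, one_mul]; exact hGneg u hu
    · rw [h, neg_one_mul, neg_one_mul, neg_lt_zero]
      have := hGpos (-u) ⟨by linarith [hu.2], by linarith [hu.1]⟩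
      simpa [hGdef, neg_div] using this
  · rw [hg]
    rcases hε with h | h
    · rw [h, one_mul, one_mul]; exact hGpos u hu
    · rw [h, neg_one_mul, neg_one_mul, neg_pos]
      have := hGneg (-u) ⟨by linarith [hu.2], by linarith [hu.1]⟩
      simpa [hGdef, neg_div] using this

end Summit.HubbardSuperconductivity.HubbardSuperconductivity.Theorems.NodalDiracTwist
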